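import Literature.Geometry.Riemannian.HeatKernelGradientEstimate
import Literature.Geometry.Riemannian.LipschitzSmoothing
import Literature.Geometry.Riemannian.MetricFlowPhiLipschitz
import HarnessLib

/-!
# The gradient property of the heat kernel measures of a Ricci flow for Lipschitz data
# (Bamler 2023, Def. 3.2 (6), case `T > 0`)

R. Bamler, *Compactness theory of the space of super Ricci flows*, Invent. Math. 233 (2023),
Def. 3.2 (6) (the gradient property of a metric flow), case `T > 0`: if `u_s = Φ ∘ f` on the
time-`s` slice with `f` `T^{-1/2}`-Lipschitz, then `x ↦ ∫ u_s dν_{x,t;s}` is of the form `Φ ∘ f'`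
with `f'` `(t − s + T)^{-1/2}`-Lipschitz for the distance of the time-`t` slice. This file proves
it for the heat kernel measures `ν_{x,t;s}` (`heatKernelMeasure`, `HeatKernelMeasures.lean`) of a
`C^∞` family `h` of Riemannian metrics on a closed manifold `M` (modelled on `ℝᵐ`) which is a
Ricci flow on `[s, t]`, the Lipschitz conditions being stated for the Riemannian distances
`d_{h(s)}`, `d_{h(t)}` (`PseudoRiemannianMetric.edist`) in `ℝ≥0∞` (points at infinite distance
impose nothing):

* `IsRicciFlow.exists_lipschitz_integral_Phi_comp_eq` — for `f : M → ℝ` continuous and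
  `T^{-1/2}`-Lipschitz for `d_{h(s)}`, `T > 0`, there is `f' : M → ℝ`,
  `(t − s + T)^{-1/2}`-Lipschitz for `d_{h(t)}`, with `∫ Φ ∘ f dν_{x,t;s} = Φ (f' x)` for all `x`.

Proof (the approximation argument reducing to smooth data, Bamler 2020a, Thm. 4.1): smooth
`fₙ → f` uniformly with `|∇fₙ|²_{h(s)} ≤ (T^{-1/2} + 1/(n+1))²` (Greene–Wu smoothing,
`exists_contMDiff_abs_sub_lt_gradSq_le`); for the smooth data `uₙ = Φ ∘ fₙ : M → (0, 1)` the
function `Φ⁻¹ ∘ ∫ uₙ dν_{·,t;s}` is `(Tₙ + t − s)^{-1/2}`-Lipschitz, `Tₙ = (T^{-1/2} + 1/(n+1))⁻²`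
(`IsRicciFlow.ofReal_abs_PhiInv_sub_PhiInv_le`, `HeatKernelGradientEstimate.lean`); dominated
convergence `∫ uₙ dν → ∫ Φ ∘ f dν ∈ (0, 1)`, continuity of `Φ⁻¹` on `(0, 1)` and `Tₙ → T` pass the
bound to the limit `f' = Φ⁻¹ ∘ ∫ Φ ∘ f dν_{·,t;s}`.

Everything is proved; no definitions, no named facts. What is NOT here: the case `T = 0`
(bounded measurable data, the strong Feller property) of Def. 3.2 (6).

## References

* R. H. Bamler, *Compactness theory of the space of super Ricci flows*, Invent. Math. 233 (2023),
  1121–1277, §3.1 Def. 3.2 (6), §3.7. [Bamler2023]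
* R. H. Bamler, *Entropy and heat kernel bounds on a Ricci flow background*, arXiv:2008.07093
  (2020), §4.1, Thm. 4.1. [Bamler2020Entropy]
-/

noncomputable section

open Bundle Set Function Filter Manifold MeasureTheory Measure TopologicalSpace
open scoped Manifold ContDiff Topology ENNReal NNReal

/-! ### Gradient property for Lipschitz data (`T > 0`) -/

namespace Literature.Geometry.Riemannian

open Lorentzian Lorentzian.PseudoRiemannianMetric MetricFlow

section LipschitzData

variable {m : ℕ} {H : Type*} [TopologicalSpace H]
  {I : ModelWithCorners ℝ (EuclideanSpace ℝ (Fin m)) H} [I.Boundaryless]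
  {M : Type*} [TopologicalSpace M] [ChartedSpace H M] [IsManifold I ∞ M]
  [T2Space M] [CompactSpace M] [SecondCountableTopology M] [MeasurableSpace M] [BorelSpace M]
  {h : ℝ → PseudoRiemannianMetric I ∞ (EuclideanSpace ℝ (Fin m)) (TangentSpace I : M → Type _)}
  (hh : IsContMDiffFamilyOn ∞ h univ) (hR : ∀ r, (h r).IsRiemannian)

/-- **Bamler 2023, Def. 3.2 (6), case `T > 0`, for the heat kernel measures of a Ricci flow.**
Let `h` be a `C^∞` family of Riemannian metrics on the closed manifold `M` which is a Ricci flow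
on `[s, t]`, `s < t`, let `T > 0` and let `f : M → ℝ` be continuous and `T^{-1/2}`-Lipschitz for
the Riemannian distance of `h(s)`. Then there is `f' : M → ℝ`, `(t − s + T)^{-1/2}`-Lipschitz for
the Riemannian distance of `h(t)`, such that `∫ Φ ∘ f dν_{x,t;s} = Φ (f' x)` for every `x`
("if `u_s = Φ ∘ f` with `f` `T^{-1/2}`-Lipschitz then `x ↦ ∫ u_s dν_{x;s}` is of the form `Φ ∘ f'`
with `f'` `(t − s + T)^{-1/2}`-Lipschitz"). Proof: smooth approximation `fₙ` of `f` with
`|∇fₙ|² ≤ (T^{-1/2} + 1/(n+1))²` (`exists_contMDiff_abs_sub_lt_gradSq_le`), Theorem 4.1 of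
Bamler 2020a in Lipschitz form for the smooth data `Φ ∘ fₙ`
(`IsRicciFlow.ofReal_abs_PhiInv_sub_PhiInv_le`), and a passage to the limit (dominated
convergence, continuity of `Φ⁻¹` on `(0, 1)`). [cite: Bamler2023, §3.1, Def. 3.2 (6)] -/
theorem IsRicciFlow.exists_lipschitz_integral_Phi_comp_eq {s t : ℝ} (hst : s < t)
    {cov : ℝ → CovariantDerivative I (EuclideanSpace ℝ (Fin m)) (TangentSpace I : M → Type _)}
    (hflow : IsRicciFlow h cov (Icc s t))
    {T : ℝ} (hT : 0 < T) {f : M → ℝ} (hfc : Continuous f)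
    (hf : ∀ x y, ENNReal.ofReal |f x - f y| ≤
      ENNReal.ofReal (1 / Real.sqrt T) * (h s).edist (hR s) x y) :
    ∃ f' : M → ℝ,
      (∀ x y, ENNReal.ofReal |f' x - f' y| ≤
        ENNReal.ofReal (1 / Real.sqrt (t - s + T)) * (h t).edist (hR t) x y) ∧
      ∀ x, ∫ z, Phi (f z) ∂(heatKernelMeasure hh hR t x s) = Phi (f' x) := by
  -- `Φ ∘ f` is continuous with values in some `[a, b] ⊂ (0, 1)`, hence so is its propagation `U`
  have hΦf : Continuous fun z ↦ Phi (f z) := differentiable_Phi.continuous.comp hfc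
  obtain ⟨a, b, ha, hb, hab⟩ := exists_Icc_subset_Ioo_of_continuous (M := M) hΦf
    fun z ↦ ⟨Phi_pos _, Phi_lt_one _⟩
  set U : M → ℝ := fun x ↦ ∫ z, Phi (f z) ∂(heatKernelMeasure hh hR t x s)
  have hU01 : ∀ x, U x ∈ Ioo (0 : ℝ) 1 := fun x ↦ by
    have hx := integral_heatKernelMeasure_mem_Icc hh hR t x s hΦf (fun z ↦ (hab z).1)
      fun z ↦ (hab z).2
    exact ⟨ha.trans_le hx.1, hx.2.trans_lt hb⟩
  refine ⟨fun x ↦ PhiInv (U x), fun x y ↦ ?_, fun x ↦ (Phi_PhiInv (hU01 x).1 (hU01 x).2).symm⟩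
  -- smooth approximants `χ n` of `f`: `|χ n - f| < 1/(n+1)`, `|∇(χ n)|² ≤ (T^{-1/2} + 1/(n+1))²`
  have hL : (0 : ℝ) ≤ 1 / Real.sqrt T := by positivity
  have hsm : ∀ n : ℕ, ∃ χ : M → ℝ, ContMDiff I 𝓘(ℝ, ℝ) ∞ χ ∧
      (∀ z, |χ z - f z| < 1 / ((n : ℝ) + 1)) ∧
      ∀ z, (h s).gradSq χ z ≤ (1 / Real.sqrt T + 1 / ((n : ℝ) + 1)) ^ 2 := fun n ↦
    exists_contMDiff_abs_sub_lt_gradSq_le (h s) (hR s) hfc hL hf (by positivity)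
  choose χ hχs hχf hχg using hsm
  have hLn : ∀ n : ℕ, (0 : ℝ) < 1 / Real.sqrt T + 1 / ((n : ℝ) + 1) := fun n ↦ by positivity
  -- Theorem 4.1 in Lipschitz form for the smooth data `Φ ∘ χ n`, with `Tₙ = (T^{-1/2} + 1/(n+1))⁻²`
  have hlip : ∀ n : ℕ,
      ENNReal.ofReal |PhiInv (∫ z, Phi (χ n z) ∂(heatKernelMeasure hh hR t x s)) -
          PhiInv (∫ z, Phi (χ n z) ∂(heatKernelMeasure hh hR t y s))| ≤
        ENNReal.ofReal (1 / Real.sqrt (((1 / Real.sqrt T + 1 / ((n : ℝ) + 1)) ^ 2)⁻¹ + (t - s))) *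
          (h t).edist (hR t) x y := by
    intro n
    refine hflow.ofReal_abs_PhiInv_sub_PhiInv_le hh hR hst (u₀ := fun z ↦ Phi (χ n z))
      (contDiff_Phi.comp_contMDiff (hχs n)) (fun z ↦ ⟨Phi_pos _, Phi_lt_one _⟩)
      (inv_nonneg.2 (sq_nonneg _)) (fun z ↦ ?_) ⟨hst.le, le_rfl⟩ (by positivity) x y
    simp only [PhiInv_Phi]
    rw [inv_mul_le_iff₀ (pow_pos (hLn n) 2), mul_one]
    exact hχg n z
  -- `∫ Φ ∘ χ n dν_{w,t;s} → U w` (dominated convergence), hence `Φ⁻¹ ∘ … → Φ⁻¹ (U w)`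
  have hconv : ∀ w : M, Tendsto (fun n ↦ ∫ z, Phi (χ n z) ∂(heatKernelMeasure hh hR t w s))
      atTop (𝓝 (U w)) := by
    intro w
    refine tendsto_integral_of_dominated_convergence (fun _ ↦ (1 : ℝ))
      (fun n ↦ (contDiff_Phi.comp_contMDiff (hχs n)).continuous.aestronglyMeasurable)
      (integrable_const 1) (fun n ↦ Eventually.of_forall fun z ↦ ?_)
      (Eventually.of_forall fun z ↦ ?_)
    · rw [Real.norm_eq_abs, abs_of_pos (Phi_pos _)]
      exact (Phi_lt_one _).le
    · have hz : Tendsto (fun n ↦ χ n z) atTop (𝓝 (f z)) := by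
        rw [tendsto_iff_norm_sub_tendsto_zero]
        exact squeeze_zero (fun n ↦ norm_nonneg _) (fun n ↦ (hχf n z).le)
          tendsto_one_div_add_atTop_nhds_zero_nat
      exact (differentiable_Phi.continuous.tendsto _).comp hz
  have hF : ∀ w : M,
      Tendsto (fun n ↦ PhiInv (∫ z, Phi (χ n z) ∂(heatKernelMeasure hh hR t w s))) atTop
        (𝓝 (PhiInv (U w))) :=
    fun w ↦ tendsto_PhiInv_comp (hU01 w).1 (hU01 w).2 (hconv w)
  -- the constants: `Tₙ → T`, `(Tₙ + (t - s))^{-1/2} → (t - s + T)^{-1/2}`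
  have hTn : Tendsto (fun n : ℕ ↦ ((1 / Real.sqrt T + 1 / ((n : ℝ) + 1)) ^ 2)⁻¹) atTop (𝓝 T) := by
    have h1 : Tendsto (fun n : ℕ ↦ (1 / Real.sqrt T + 1 / ((n : ℝ) + 1)) ^ 2) atTop
        (𝓝 ((1 / Real.sqrt T) ^ 2)) := by
      have hc : Tendsto (fun _ : ℕ ↦ 1 / Real.sqrt T) atTop (𝓝 (1 / Real.sqrt T)) :=
        tendsto_const_nhds
      simpa only [add_zero] using (hc.add tendsto_one_div_add_atTop_nhds_zero_nat).pow 2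
    have h2 : ((1 / Real.sqrt T) ^ 2)⁻¹ = T := by
      rw [div_pow, one_pow, Real.sq_sqrt hT.le, inv_div, div_one]
    have h3 := h1.inv₀ (by positivity)
    rwa [h2] at h3
  have hcoef : Tendsto
      (fun n : ℕ ↦ 1 / Real.sqrt (((1 / Real.sqrt T + 1 / ((n : ℝ) + 1)) ^ 2)⁻¹ + (t - s))) atTop
      (𝓝 (1 / Real.sqrt (t - s + T))) := by
    rw [show t - s + T = T + (t - s) by ring]
    exact tendsto_const_nhds.div (hTn.add tendsto_const_nhds).sqrt
      (Real.sqrt_pos.2 (by linarith)).ne'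
  -- pass to the limit in the Lipschitz bounds
  refine le_of_tendsto_of_tendsto' (ENNReal.tendsto_ofReal ((hF x).sub (hF y)).abs)
    (ENNReal.Tendsto.mul_const (ENNReal.tendsto_ofReal hcoef)
      (Or.inl (ENNReal.ofReal_pos.2 (by positivity)).ne')) hlip

end LipschitzData

end Literature.Geometry.Riemannian
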